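import Summits.HodgeConjecture.HodgeConjecture.Theorems.VHCAbelianSchemesRoadHomFunctorPullbackComparison
import Summits.Ventures.HSemireg.HomComplexSupertracePushforward
import Literature.AlgebraicGeometry.HodgeTheory.TwistHodgePullback
import HarnessLib

/-!
# Road №4 (`VHCAbelianSchemesRoad`), crux stmt-HodgeConjecture-26512 `DiagLocalOfMarkmanPinnedForall` — support line «sigma-descent-along-q»,
# library item (L2) `SigmaPullbackCompat`, step (Q5): **THE SUPERTRACE `Tr•^H : 𝓗om•(K, K ⊗ Ω^q) ⟶ Ω^q[0]` ALONG THE PULL-BACK BY A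
# MORPHISM OF `S`-SCHEMES** — the pull-back twin of `Summits/Ventures/HSemireg/HomComplexSupertracePushforward` (piece (N5) there)

research route conditional on HC_CM; not a corollary; Q11.4-sentence-2 already refuted in dim ≥ 3.

Seat core-w5 gen 6 (width copy «width 5» of core-D; claim-free, `--supports stmt-HodgeConjecture-26512 --as helper`; director-hodge g18
R18.14 (2) PIECE A, owner of record R18.20). HONEST FRAMING: kernel bookkeeping on the venture's real carriers (`HomComplex.homFunctor`,
`twistHodgeComplex`, `supertraceH`, `str₀` of `HomComplexSigma.lean` ∕ `HomComplexSupertrace.lean` ∕ `ComplexAtiyahClass.lean`); nothing about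
any variety; proves NOTHING about (L2), (Q4), (U-Σ), (N-U), any registered stub, 26512, №4, HC_AV, HC_CM or HC; HC_CM HELD, by name only;
typed ≠ proved. Declared in the cell's namespace `Summit.HodgeConjecture.HodgeConjecture.Ring2.SemiregularRepresentatives` (as the step (Q1)
file `VHCAbelianSchemesRoadHomFunctorPullbackComparison.lean`), with the venture's names opened.

For ANY morphism `g : X₀ ⟶ X₁` of `S`-schemes (`g^* = Scheme.Modules.pullback g.left`, `g^*•` termwise on cochain complexes), a cochain
complex `K` of `𝒪_{X₁}`-modules with finite locally free terms and `K' = g^*•K`: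

* §1 **`twistHodgeComplexPullbackHom g j K hK : g^*•(K ⊗ Ωʲ_{X₁}) ⟶ K' ⊗ Ωʲ_{X₀}`** (`α_j•`) — termwise the module-level comparison
  `Literature.AlgebraicGeometry.HodgeTheory.twistHodgePullbackHom` (`α_j = ` twist comparison `≫ 𝓗om((g^*K^i)^∨, dg)`), a chain map by
  its naturality in the module; this is also the comparison that step (Q4) (the Atiyah powers along `g^*`) composes with;
* §2 the two summand computations in degree `0` (`map_ι_comp_map_str₀_pullback`, `map_ι_comp_comparison_comp_str₀`: on the summand
  `𝓗om(K^{-i}, K^{-i} ⊗ Ω^q)` both sides are `(-1)^i` times the module-level core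
  `Literature.AlgebraicGeometry.HodgeTheory.pullback_map_contract_comp_pullbackForms`);
* §3 **`map_supertraceH_comp_pullbackForms`** — `g^*•(Tr•^H_K) ≫ (g^*•(Ω^q_{X₁}[0]) ≅ (g^*Ω^q_{X₁})[0]) ≫ dg[0] =
  τ_{K ⊗ Ω^q} ≫ 𝓗om•(K', α_q•) ≫ Tr•^H_{K'}` as morphisms `g^*• 𝓗om•(K, K ⊗ Ω^q_{X₁}) ⟶ Ω^q_{X₀}[0]`, where `τ` is (Q1)'s
  `homFunctorPullbackHomApp` and `dg = pullbackForms g q` (compare degree-`0` components summand by summand, `pullback_ι_hom_ext`).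
  The second and third factors of the left-hand side ARE the `formsSingleComparison` of `Cruxes/…/SigmaDescent.lean` at
  `g := D.q.hom.hom.hom` (`Hom.toSchemeHom D.q = g.left` by `abbrev`), so this is the (N5)-shaped input of the (Dq-σ) assembly
  next to (Q2) `HomComplexUnitPullback`, (Q3′) `…DerivedDescentBaseChangeNatTrans` and (Q4).

References: R.-O. Buchweitz, H. Flenner, Compositio Math. 137 (2003), §3 (functoriality of the trace maps under base change), §4 (trace maps)
and Def. 4.1 [BuchweitzFlenner2003]; R. Hartshorne (1977), II Ex. 5.1 (b), II §5 p. 110, II Prop. 8.11 [Hartshorne1977]; C. A. Weibel (1994),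
§1.2 (1.2.6), §2.6 [Weibel1994]. Bookkeeping along a pull-back (reading; no printed statement is typed verbatim).
-/

noncomputable section

-- `TopCat.Presheaf`/`Scheme.Modules`/`GradedObject` are not reducible.
set_option backward.isDefEq.respectTransparency false

open CategoryTheory CategoryTheory.Category CategoryTheory.Limits AlgebraicGeometry Opposite

universe u

namespace Summit.HodgeConjecture.HodgeConjecture.Ring2.SemiregularRepresentatives

set_option linter.dupNamespace false -- the cell's namespace repeats the summit name, as in every `Ring2*` file

open Literature.AlgebraicGeometry.Modules Literature.AlgebraicGeometry.Motives
open Literature.AlgebraicGeometry.HodgeTheory (twistHodge twistHodgePullbackHom twistHodgePullbackHom_naturality pullbackForms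
  pullback_map_contract_comp_pullbackForms)
open Summit.Ventures.HSemireg Summit.Ventures.HSemireg.HomComplex

variable {S : Type u} [CommRing S] {X₀ X₁ : Over (Spec (CommRingCat.of S))} (g : X₀ ⟶ X₁)

/-! ## §1 The chain-level comparison `α_j• : g^*•(K ⊗ Ωʲ) ⟶ (g^*•K) ⊗ Ωʲ` -/

section ChainLevel

variable (j : ℕ) (K : CochainComplex X₁.left.Modules ℤ) (hK : ∀ p, IsFiniteLocallyFree (K.X p))

/-- **`α_j• : g^*•(K ⊗ Ωʲ_{X₁}) ⟶ (g^*•K) ⊗ Ωʲ_{X₀}`** — termwise `α_j = twistHodgePullbackHom g (hK i) j`, a chain map because `α_j` is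
natural in the module (`twistHodgePullbackHom_naturality`; the differentials of `K ⊗ Ωʲ` are `d ⊗ 1 = 𝓗om(d^∨, Ωʲ)`).
[cite: BuchweitzFlenner2003, §3 (functoriality under base change; reading: E• ⊗ Ω along g^*)] [cite: Hartshorne1977, II Ex. 5.1 (b) and II Prop. 8.11] -/
def twistHodgeComplexPullbackHom :
    ((Scheme.Modules.pullback g.left).mapHomologicalComplex (ComplexShape.up ℤ)).obj (twistHodgeComplex X₁ j K) ⟶
      twistHodgeComplex X₀ j (((Scheme.Modules.pullback g.left).mapHomologicalComplex (ComplexShape.up ℤ)).obj K) where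
  f i := twistHodgePullbackHom g (hK i) j
  comm' i i' _ := by
    change twistHodgePullbackHom g (hK i) j ≫
        sheafHomMapLeft (sheafHomMapLeft ((Scheme.Modules.pullback g.left).map (K.d i i')) (unitModule X₀.left)) (hodgeSheaf X₀ j) =
      (Scheme.Modules.pullback g.left).map (sheafHomMapLeft (sheafHomMapLeft (K.d i i') (unitModule X₁.left)) (hodgeSheaf X₁ j)) ≫
        twistHodgePullbackHom g (hK i') j
    exact (twistHodgePullbackHom_naturality g j (K.d i i') (hK i) (hK i')).symm

/-- Components of `α_j•` (definitional). [cite: Hartshorne1977, II Ex. 5.1 (b) and II Prop. 8.11] -/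
@[simp]
theorem twistHodgeComplexPullbackHom_f (i : ℤ) : (twistHodgeComplexPullbackHom g j K hK).f i = twistHodgePullbackHom g (hK i) j := rfl

end ChainLevel

/-! ## §2 The two summands in degree `0` -/

section Summands

variable (K : CochainComplex X₁.left.Modules ℤ) (hK : ∀ p, IsFiniteLocallyFree (K.X p))
  (hK' : ∀ p, IsFiniteLocallyFree ((((Scheme.Modules.pullback g.left).mapHomologicalComplex (ComplexShape.up ℤ)).obj K).X p))

/-- The left summand: `g^*(ι_{-i,i}) ≫ g^*(𝓗om•(K, (K ⊗ Ω^q ≅ K ⊗ G))_0) ≫ g^*(str₀) = (-1)^i • g^*(c^{K^{-i}}_{Ω^q})` (any functor; the venture's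
`map_ι_comp_map_str₀` with `g^*` for `e_*`). [cite: BuchweitzFlenner2003, §4 (trace map, the sign (-1)^i on 𝓗om(K^{-i}, K^{-i} ⊗ G))] -/
theorem map_ι_comp_map_str₀_pullback (q : ℕ) (i : ℤ) (h : -i + i = 0) :
    (Scheme.Modules.pullback g.left).map (ι X₁.left K (twistHodgeComplex X₁ q K) (-i) i 0 h) ≫
        (Scheme.Modules.pullback g.left).map (((homFunctor X₁.left K).map (twistHodgeIsoG X₁ K q).hom).f 0) ≫
          (Scheme.Modules.pullback g.left).map (str₀ X₁.left (hodgeSheaf X₁ q) K hK) =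
      (i.negOnePow : ℤ) • (Scheme.Modules.pullback g.left).map (contract (hK (-i)) (hodgeSheaf X₁ q)) := by
  rw [← Functor.map_comp, ← Functor.map_comp, homFunctor_map_f,
    reassoc_of% (ι_map X₁.left K (twistHodgeIsoG X₁ K q).hom (-i) i 0 h), ι_str₀]
  erw [show (twistHodgeIsoG X₁ K q).hom.f (-i) = 𝟙 _ from rfl, sheafHomMap_id, Category.id_comp]
  simp only [strComp, HomologicalComplex.XIsoOfEq_rfl, Iso.refl_hom, sheafHomMap_id, Category.id_comp, Units.smul_def,
    Functor.map_zsmul]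

/-- The right summand: `g^*(ι) ≫ τ_0 ≫ 𝓗om•(K', α_q•)_0 ≫ 𝓗om•(K', (≅))_0 ≫ str₀' =
(-1)^i • ((g^*𝓗om ⟶ 𝓗om g^*) ≫ 𝓗om(g^*K^{-i}, α_q) ≫ c')` (summand formula of (Q1)'s comparison, `map_ι_comp_homFunctorPullbackHomApp_f`).
[cite: BuchweitzFlenner2003, §4 (trace map)] [cite: Weibel1994, §1.2, 1.2.6] -/
theorem map_ι_comp_comparison_comp_str₀ (q : ℕ) (i : ℤ) (h : -i + i = 0) :
    (Scheme.Modules.pullback g.left).map (ι X₁.left K (twistHodgeComplex X₁ q K) (-i) i 0 h) ≫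
        (homFunctorPullbackHomApp g.left K (twistHodgeComplex X₁ q K)).f 0 ≫
          (((homFunctor X₀.left (((Scheme.Modules.pullback g.left).mapHomologicalComplex (ComplexShape.up ℤ)).obj K)).map
              (twistHodgeComplexPullbackHom g q K hK)).f 0) ≫
            (((homFunctor X₀.left (((Scheme.Modules.pullback g.left).mapHomologicalComplex (ComplexShape.up ℤ)).obj K)).map
                (twistHodgeIsoG X₀ (((Scheme.Modules.pullback g.left).mapHomologicalComplex (ComplexShape.up ℤ)).obj K) q).hom).f 0) ≫
              str₀ X₀.left (hodgeSheaf X₀ q) (((Scheme.Modules.pullback g.left).mapHomologicalComplex (ComplexShape.up ℤ)).obj K) hK' =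
      (i.negOnePow : ℤ) • (sheafHomPullbackComparison g.left (K.X (-i)) (twistHodge (K.X (-i)) q) ≫
        sheafHomMap ((Scheme.Modules.pullback g.left).obj (K.X (-i))) (twistHodgePullbackHom g (hK (-i)) q) ≫
          contract (hK' (-i)) (hodgeSheaf X₀ q)) := by
  rw [reassoc_of% (map_ι_comp_homFunctorPullbackHomApp_f g.left K (twistHodgeComplex X₁ q K) (-i) i 0 h),
    homFunctor_map_f, homFunctor_map_f,
    reassoc_of% (ι_map X₀.left (((Scheme.Modules.pullback g.left).mapHomologicalComplex (ComplexShape.up ℤ)).obj K)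
      (twistHodgeComplexPullbackHom g q K hK) (-i) i 0 h),
    reassoc_of% (ι_map X₀.left (((Scheme.Modules.pullback g.left).mapHomologicalComplex (ComplexShape.up ℤ)).obj K)
      (twistHodgeIsoG X₀ (((Scheme.Modules.pullback g.left).mapHomologicalComplex (ComplexShape.up ℤ)).obj K) q).hom (-i) i 0 h),
    ι_str₀, twistHodgeComplexPullbackHom_f]
  erw [show (twistHodgeIsoG X₀ (((Scheme.Modules.pullback g.left).mapHomologicalComplex (ComplexShape.up ℤ)).obj K) q).hom.f (-i) =
    𝟙 _ from rfl, sheafHomMap_id, Category.id_comp]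
  simp only [strComp, HomologicalComplex.XIsoOfEq_rfl, Iso.refl_hom, sheafHomMap_id, Category.id_comp, Units.smul_def,
    Preadditive.comp_zsmul]
  rfl

end Summands

/-! ## §3 The supertrace along `g^*•` -/

section Supertrace

variable (K : CochainComplex X₁.left.Modules ℤ) (hK : ∀ p, IsFiniteLocallyFree (K.X p))
  (hK' : ∀ p, IsFiniteLocallyFree ((((Scheme.Modules.pullback g.left).mapHomologicalComplex (ComplexShape.up ℤ)).obj K).X p))

/-- **The supertrace along the pull-back by a morphism of `S`-schemes**:
`g^*•(Tr•^H_K) ≫ (g^*•(Ω^q_{X₁}[0]) ≅ (g^*Ω^q_{X₁})[0]) ≫ dg[0] = τ_{K ⊗ Ω^q} ≫ 𝓗om•(g^*•K, α_q•) ≫ Tr•^H_{g^*•K}` as morphisms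
`g^*• 𝓗om•(K, K ⊗ Ω^q_{X₁}) ⟶ Ω^q_{X₀}[0]`, for every `q` and every cochain complex `K` with finite locally free terms (`τ` = (Q1)'s
`homFunctorPullbackHomApp`, `α_q•` = `twistHodgeComplexPullbackHom`, `dg = pullbackForms g q`): a morphism into a single complex, so compare
degree-`0` components summand by summand (`pullback_ι_hom_ext`); on `𝓗om(K^{-i}, K^{-i} ⊗ Ω^q)` both sides are `(-1)^i` times the module-level
`pullback_map_contract_comp_pullbackForms`. Buchweitz–Flenner's functoriality of the trace maps under base change, at chain level, for any `g`.
[cite: BuchweitzFlenner2003, §3 (functoriality of the trace under base change) and §4 (the trace map Tr : Ext^k(F, F ⊗ G) → H^k(X, G))]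
[cite: Hartshorne1977, II Ex. 5.1 (b) and II Prop. 8.11] -/
theorem map_supertraceH_comp_pullbackForms (q : ℕ) :
    ((Scheme.Modules.pullback g.left).mapHomologicalComplex (ComplexShape.up ℤ)).map (supertraceH X₁ K hK q) ≫
        (HomologicalComplex.singleMapHomologicalComplex (Scheme.Modules.pullback g.left) (ComplexShape.up ℤ) 0).hom.app
            (hodgeSheaf X₁ q) ≫
          (HomologicalComplex.single X₀.left.Modules (ComplexShape.up ℤ) 0).map (pullbackForms g q) =
      homFunctorPullbackHomApp g.left K (twistHodgeComplex X₁ q K) ≫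
        (homFunctor X₀.left (((Scheme.Modules.pullback g.left).mapHomologicalComplex (ComplexShape.up ℤ)).obj K)).map
            (twistHodgeComplexPullbackHom g q K hK) ≫
          supertraceH X₀ (((Scheme.Modules.pullback g.left).mapHomologicalComplex (ComplexShape.up ℤ)).obj K) hK' q := by
  refine HomologicalComplex.to_single_hom_ext ?_
  simp only [HomologicalComplex.comp_f, Functor.mapHomologicalComplex_map_f,
    HomologicalComplex.singleMapHomologicalComplex_hom_app_self, HomologicalComplex.single_map_f_self, Category.assoc,
    Iso.inv_hom_id_assoc, supertraceH_f_zero, Functor.map_comp, Iso.map_inv_hom_id_assoc]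
  refine pullback_ι_hom_ext g.left K fun p i hpi => ?_
  obtain rfl : p = -i := by omega
  rw [reassoc_of% (map_ι_comp_map_str₀_pullback g K hK q i hpi), reassoc_of% (map_ι_comp_comparison_comp_str₀ g K hK hK' q i hpi),
    Preadditive.zsmul_comp, Preadditive.zsmul_comp, reassoc_of% (pullback_map_contract_comp_pullbackForms g (hK (-i)) q)]
  simp only [Category.assoc]

/-- **The same, with the pulled-back local freeness witnesses `(hK p).pullback g.left`** (the spelling of `Cruxes/…/SigmaDescent.lean`'s
`SigmaPullbackCompatAt`, whose `σ` upstairs is taken at `fun i => (hE i).pullback (Hom.toSchemeHom D.q)`). [cite: BuchweitzFlenner2003, §3 and §4] -/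
theorem map_supertraceH_comp_pullbackForms' (q : ℕ) :
    ((Scheme.Modules.pullback g.left).mapHomologicalComplex (ComplexShape.up ℤ)).map (supertraceH X₁ K hK q) ≫
        (HomologicalComplex.singleMapHomologicalComplex (Scheme.Modules.pullback g.left) (ComplexShape.up ℤ) 0).hom.app
            (hodgeSheaf X₁ q) ≫
          (HomologicalComplex.single X₀.left.Modules (ComplexShape.up ℤ) 0).map (pullbackForms g q) =
      homFunctorPullbackHomApp g.left K (twistHodgeComplex X₁ q K) ≫
        (homFunctor X₀.left (((Scheme.Modules.pullback g.left).mapHomologicalComplex (ComplexShape.up ℤ)).obj K)).map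
            (twistHodgeComplexPullbackHom g q K hK) ≫
          supertraceH X₀ (((Scheme.Modules.pullback g.left).mapHomologicalComplex (ComplexShape.up ℤ)).obj K)
            (fun p => (hK p).pullback g.left) q :=
  map_supertraceH_comp_pullbackForms g K hK (fun p => (hK p).pullback g.left) q

end Supertrace

end Summit.HodgeConjecture.HodgeConjecture.Ring2.SemiregularRepresentatives

end
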